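import Summits.BirchSwinnertonDyer.BirchSwinnertonDyer.Theses.ResidualThetaTransportAtTwo

/-!
# Crux idea `cm-manin-period` (k1, g28) for `SignedMuSeedAtTwoPlus` (stmt-BirchSwinnertonDyer-21438)

Sketch file: the FIRST LEMMA of the line (proved) and the typed transfer statement (E4 as a theorem,
`ℚ`-slice).  BSD is not proved here; the crux stays OPEN.

Line in one sentence: the period-parity input (E4) of the `k = 2` programme — «the cohomological plus
period of the CM theta partner `g = θ_φ` is the Néron CM period `Ω_K` up to a `2`-adic unit and the
universal factor `1/2`» — is a THEOREM, by GL₂-geometry of the optimal quotient `B_g` of `J₀(M)`: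
mod-`2` multiplicity one for the supersingular residual representation (Buzzard; `T₂ ∈ 𝔪`) ⇒ `𝕋_𝔪`
Gorenstein ⇒ the `𝔪`-part of the generalised Manin conjecture (Česnavičius 2018 §5) ⇒ `ω_g` is
Néron-primitive at `𝔪` ⇒ (INERT-2 rigidity: `𝒪_K ⊗ ℤ₂ ⊆ End B_g ⊗ ℤ₂` because `#(𝒪_K/2)^× = 3`)
Serre-tensor model `B_g ≃ (𝔐 ⊗_{𝒪_K} E)/C_odd` ⇒ periods of `ω_g` are `Ω_K^{Nér}·𝔑` with `𝔑 ⊄ 𝔓`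
⇒ (`d_K ≡ 5 mod 8` non-cancellation, the lemma below) `Ω_g^{coh,±} = (Ω_K^{Nér}/2)·unit`.
-/

namespace Summit.BirchSwinnertonDyer.BirchSwinnertonDyer.Cruxes.SignedMuSeedAtTwoPlus.CMManinPeriod

/-- **First lemma (Re/Im non-cancellation at an inert prime), PROVED.**  In a local ring `R` with a ring
endomorphism `σ` (complex conjugation on `𝒪̄_(𝔓)`), an element `ω` with `ω − σ ω` a unit (`ω = (1+√d_K)/2`,
`ω − ω̄ = √d_K`, a `2`-adic unit exactly when `2` is unramified in `K`), a sign/twist `ε` (the unit `Ω̄/Ω`)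
and a unit `x` (a primitive period coordinate): the two "real parts" `x + ε σx` and `xω + ε σx σω` are not
both non-units.  This is the step `min_γ v_𝔓(Re ∫_γ ω_g / Ω_K) = v(1/2)` of the line. -/
theorem reIm_nonCancellation {R : Type*} [CommRing R] [IsLocalRing R] (σ : R →+* R) (ε ω x : R)
    (hω : IsUnit (ω - σ ω)) (hx : IsUnit x) :
    IsUnit (x + ε * σ x) ∨ IsUnit (x * ω + ε * σ x * σ ω) := by
  have key : (x * ω + ε * σ x * σ ω) + (-(σ ω) * (x + ε * σ x)) = x * (ω - σ ω) := by ring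
  have hu : IsUnit ((x * ω + ε * σ x * σ ω) + (-(σ ω) * (x + ε * σ x))) := by
    rw [key]; exact hx.mul hω
  rcases IsLocalRing.isUnit_or_isUnit_of_isUnit_add hu with h | h
  · exact Or.inr h
  · exact Or.inl (isUnit_of_mul_isUnit_right h)

/-- **Corollary used verbatim by the line:** with `x` a unit, at least one of the two plus-type
combinations is a unit, phrased as "not both lie in the maximal ideal". -/
theorem not_both_mem_maximalIdeal {R : Type*} [CommRing R] [IsLocalRing R] (σ : R →+* R) (ε ω x : R)
    (hω : IsUnit (ω - σ ω)) (hx : IsUnit x) :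
    ¬ (x + ε * σ x ∈ IsLocalRing.maximalIdeal R ∧ x * ω + ε * σ x * σ ω ∈ IsLocalRing.maximalIdeal R) := by
  rintro ⟨h1, h2⟩
  rcases reIm_nonCancellation σ ε ω x hω hx with h | h
  · exact (IsLocalRing.mem_maximalIdeal _ |>.mp h1) h
  · exact (IsLocalRing.mem_maximalIdeal _ |>.mp h2) h

open Literature.NumberTheory.EllipticCurves Literature.NumberTheory.EllipticCurves.ModularForms
  Literature.NumberTheory.EllipticCurves.Rank1Residual Literature.NumberTheory.Automorphic

/-- **E4 as a theorem — `ℚ`-slice (TRANSFER statement `C⁺`, to be proved by the line; typed over existing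
declarations).**  Let `g` be a newform on `Γ₀(M)`, `M` odd, with CM and `a₂(g) = 0`, `ι : K_g → ℚ̄₂`, and
`Ω` a COHOMOLOGICAL plus period of `g` along `ι` (PW Def 2.1, tree convention `plusSymbol = Re{∞,r}`).
Let `A₀/ℚ` be a globally minimal CM elliptic curve, good supersingular at `2`, with the SAME CM field as `g`
(same inert primes away from `2·M·N_{A₀}`), `Δ(A₀) < 0`.  Then for every subfield `F ⊆ ℂ` containing `K_g`
and the algebraic number `2Ω/Ω(A₀)` and every embedding `ι' : F → ℚ̄₂` extending `ι`,
`‖ι'(2Ω/Ω(A₀))‖ = 1`: the cohomological period is the Néron CM period over `2`, up to a unit.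
(General imaginary quadratic `K` with `2` inert: replace `A₀/ℚ` by an `𝒪_K`-curve over `K(j)` with a
`2`-Néron differential — same proof; this slice covers every habitat⁺ class of record, `h_K = 1`.) -/
def CMPartnerPeriodUnitAtTwo : Prop :=
  ∀ (M : ℕ) [NeZero M] (g : CuspForm (CongruenceSubgroup.Gamma0 M) 2) (ι : coeffField g →+* PadicAlgCl 2)
    (Ω : ℂ) (A₀ : WeierstrassCurve ℚ) [A₀.IsElliptic] [A₀.IsGloballyMinimal]
    (F : Subfield ℂ) (ι' : F →+* PadicAlgCl 2),
    Odd M → IsNewform0 g → IsCMForm (liftToGamma1 M 2 g) → cuspCoeff g 2 = 0 →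
    IsCohomologicalPlusPeriod g ι Ω →
    A₀.HasCM → GoodSS A₀ 2 → A₀.frobeniusTrace 2 = 0 → A₀.Δ < 0 →
    (∀ ℓ : ℕ, ℓ.Prime → ¬ ℓ ∣ 2 * M * A₀.conductorNorm ℤ →
      (cuspCoeff g ℓ = 0 ↔ A₀.frobeniusTrace ℓ = 0)) →
    ∀ (hK : ∀ x : coeffField g, (x : ℂ) ∈ F),
      (∀ x : coeffField g, ι' ⟨(x : ℂ), hK x⟩ = ι x) →
      ∀ hΩ : (2 : ℂ) * Ω / (A₀.realPeriodRat : ℂ) ∈ F, ‖ι' ⟨(2 : ℂ) * Ω / (A₀.realPeriodRat : ℂ), hΩ⟩‖ = 1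

/-- Registered-stub shape of the transfer statement (NOT registered with `skeleton check`, W-79). -/
theorem stub_cmPartnerPeriodUnitAtTwo : CMPartnerPeriodUnitAtTwo := by
  sorry

end Summit.BirchSwinnertonDyer.BirchSwinnertonDyer.Cruxes.SignedMuSeedAtTwoPlus.CMManinPeriod
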